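import Literature.MathematicalPhysics.QuantumLattice.SpinEmbedding
import Literature.MathematicalPhysics.QuantumLattice.HubbardWindowCertificateAffine
import Literature.MathematicalPhysics.QuantumLattice.HeisenbergModelProofs
import Literature.MathematicalPhysics.QuantumLattice.HeisenbergModelGlobalRotationProofs
import Literature.MathematicalPhysics.QuantumLattice.FinDimSpectrumProofs
import HarnessLib

/-!
# Window ("reduce"-mode, thermodynamic-limit) bootstrap certificates for the Heisenberg CHAIN:
# one identity in the spin algebra of a finite window bounds the energy per site of EVERY long ring

Family `hubbard` (topic `MathematicalPhysics/QuantumLattice`; calibration model of the bundle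
papers/HubbardSuperconductivity/manybody-bootstrap/). Spin-system counterpart of
`HubbardWindowCertificateAffine`: X. Han's translation-invariant bootstrap for spin chains
(arXiv:2006.06002 §2) and the bundle's reduce-mode certificates (`certsdp/1`, `family = heisenberg`,
objective `h₀ = J 𝐒_0 · 𝐒_1`, `hypotheses.reduce.point_group` = box reflection,
`zero_charge_moments`) produce ONE identity in the spin algebra `𝔄_{Λ'} = Op ↥Λ' (n+1)` of a window
`Λ' ⊆ ℤ`:

  `J 𝐒_0·𝐒_1 − c·1 = Σ Λₐᵦ Oₐᴴ O_b + (Σₖ [H_{Λ'}, Γ(incl) Bₖ] + Σₗ (Γ(incl)(Γ(affEmb εₗ vₗ) Yₗ) − Γ(incl) Yₗ)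
       + Σⱼ bⱼ • Wⱼ) + (Σₘ dₘ • (Vₘᴴ − Vₘ) + Σₖ aₖ • Mₖ)`

(`H_{Λ'}` the free Heisenberg Hamiltonian of the window; `Bₖ, Yₗ` living on an inner region `Λ`
whose neighbours lie in `Λ'`; `x ↦ εₗ x + vₗ` translations / reflections with `εₗΛ + vₗ ⊆ Λ'`; `Wⱼ`
of non-zero `S^z`-charge `[S^z_{Λ'}, Wⱼ] = mⱼ Wⱼ`; `dₘ` real; `Mₖ` contractions). Pulling the window
back into the spin ring `(ℤ/Lℤ)` by `x ↦ x mod L` (`spinEmbed`, SpinEmbedding; injective on `Λ'`)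
turns every bracket into a null term of the tracial ground state of the ring — commutators with
`H_L` (`heisenbergTorus_commutator_spinEmbed`), symmetry defects `P (Γ Y) Pᴴ − Γ Y` of the
permutation unitaries of `y ↦ εy + v` (`permOp_torusAff_commute_heisenbergHamiltonian`),
commutators with `S^z_tot` (`totalSpin_commutator_spinEmbed`), anti-Hermitian parts — and
`Σ_v P_v Γ(J 𝐒_0·𝐒_1) P_vᴴ = H_L` (`sum_permOp_conj_spinDot`, from the tree's
`heisenbergRing_eq_heisenbergHamiltonian_torusGraph_holds`), so that
`Matrix.mul_card_le_minEnergyOn_of_local_certificate` (SymmetricLocalCertificate, `K = ⊤`) and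
`Matrix.minEnergyOn_top_holds` give, for EVERY `L ≥ 3` with `x ↦ x mod L` injective on `Λ'`,

  `(c − Σₖ ‖aₖ‖) · L ≤ groundEnergy (heisenbergHamiltonian n (torusGraph 1 L) J)`

(`heisenbergChain_groundEnergy_ge_of_window_certificate`; per-site form
`heisenbergChain_groundEnergy_div_ge_of_window_certificate`, the shape of the bundle's ring-wise
thermodynamic-limit rows). Everything is PROVED; the definitions are bookkeeping site maps
(`spinToTorusEmb`, `siteIncl`, `siteAffEmb`) and the window's nearest-neighbour graph `windowGraph`.

## References
* X. Han, *Quantum many-body bootstrap*, arXiv:2006.06002 (2020), §2 (spin-chain bootstrap in the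
  thermodynamic limit: positivity, `F[[H,O]] = 0`, `F[U⁻¹OU] = F[O]`, symmetry charges).
  [cite: Han2020Bootstrap, §2]
* H. Tasaki, *Physics and Mathematics of Quantum Many-Body Systems* (Springer 2020), §2.4
  eq. (2.4.1) (Heisenberg Hamiltonian on a lattice with bond set), §2.5 eq. (2.5.2) (`SU(2)`
  invariance). [cite: Tasaki2020, §2.4–2.5]
* O. Bratteli, D. W. Robinson, *Operator Algebras and Quantum Statistical Mechanics II*, 2nd ed.,
  §6.2.1 (local structure and lattice symmetries of quantum spin systems). [cite: BratteliRobinsonII1997, §6.2.1]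
-/

noncomputable section

namespace Literature.MathematicalPhysics.QuantumLattice

open Matrix Finset Literature.Probability.LatticeModels
open Literature.MathematicalPhysics.QuantumManyBody.StateRelaxation
open scoped ComplexOrder BigOperators

/-! ### Site maps: window inclusions, affine images, and the pull-back into the torus -/

section SiteMaps

variable {d : ℕ}

/-- The inclusion of the sites of `Λ` into those of `Λ' ⊇ Λ`, as an embedding (on underlying sites
it is the identity, definitionally; cf. `subFinsetEquiv` / `coe_coe_subFinsetEquiv` in
`InfiniteVolumeStates`, the same map with codomain the copy `subFinset Λ Λ'`). [folklore] -/
def siteIncl {Λ Λ' : Finset (Site d)} (h : Λ ⊆ Λ') : ↥Λ ↪ ↥Λ' :=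
  ⟨fun x => ⟨x.1, h x.2⟩, fun _ _ hxy => Subtype.ext (by simpa using congrArg Subtype.val hxy)⟩

/-- The affine map `x ↦ εx + v` from the sites of `Λ` to those of `εΛ + v` (`affShiftSet`,
HubbardWindowCertificateAffine). [cite: BratteliRobinsonII1997, §6.2.1] -/
def siteAffEmb (ε : ℤˣ) (v : Site d) (Λ : Finset (Site d)) : ↥Λ ↪ ↥(affShiftSet ε v Λ) :=
  ⟨fun x => ⟨affSite ε v x.1, affSite_mem_affShiftSet ε v x.2⟩,
    fun _ _ hxy => Subtype.ext (affSite_injective ε v (by simpa using congrArg Subtype.val hxy))⟩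

/-- `siteAffEmb` on underlying sites. [folklore] -/
@[simp] theorem coe_siteAffEmb (ε : ℤˣ) (v : Site d) (Λ : Finset (Site d)) (x : ↥Λ) :
    ((siteAffEmb ε v Λ x : ↥(affShiftSet ε v Λ)) : Site d) = affSite ε v x := rfl

/-- **Pulling a window back into the torus**: when `x ↦ x mod L` is injective on `Λ`, it is an
injection of the sites of `Λ` into the discrete torus `(ℤ/Lℤ)^d`. [cite: BratteliRobinsonII1997, §6.2.1] -/
def spinToTorusEmb (L : ℕ) {Λ : Finset (Site d)} (h : Set.InjOn (Torus.proj (d := d) L) ↑Λ) :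
    ↥Λ ↪ TorusSite d L :=
  ⟨fun x => Torus.proj L x.1, fun x y hxy => Subtype.ext (h x.2 y.2 hxy)⟩

/-- `spinToTorusEmb` on a site. [folklore] -/
@[simp] theorem spinToTorusEmb_apply (L : ℕ) {Λ : Finset (Site d)}
    (h : Set.InjOn (Torus.proj (d := d) L) ↑Λ) (x : ↥Λ) : spinToTorusEmb L h x = Torus.proj L x := rfl

/-- `Torus.proj` is additive. [folklore] -/
private theorem torusProj_add (L : ℕ) (x y : Site d) :
    Torus.proj L (x + y) = Torus.proj L x + Torus.proj L y := by
  funext i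
  simp [Torus.proj]

/-- `Torus.proj` of a lattice unit vector is the torus unit vector. [folklore] -/
private theorem torusProj_unitVec (L : ℕ) (i : Fin d) :
    Torus.proj L (unitVec i : Site d) = Pi.single i 1 := by
  funext j
  by_cases h : j = i
  · subst h; simp [Torus.proj]
  · simp [Torus.proj, h]

/-- Restricting then pulling back is pulling back: `ι_{Λ',L} ∘ incl = ι_{Λ,L}`. [folklore] -/
theorem siteIncl_trans_spinToTorusEmb (L : ℕ) {Λ Λ' : Finset (Site d)} (hΛ : Λ ⊆ Λ')
    (h' : Set.InjOn (Torus.proj (d := d) L) ↑Λ') :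
    (siteIncl hΛ).trans (spinToTorusEmb L h') = spinToTorusEmb L (h'.mono (by exact_mod_cast hΛ)) :=
  DFunLike.ext _ _ fun _ => rfl

/-- Pulling back the affine image is the torus affine map of the pull-back:
`ι_{εΛ+v,L} ∘ affEmb = (y ↦ εy + v mod L) ∘ ι_{Λ,L}`. [folklore] -/
theorem siteAffEmb_trans_spinToTorusEmb (L : ℕ) (ε : ℤˣ) (v : Site d) {Λ : Finset (Site d)}
    (h : Set.InjOn (Torus.proj (d := d) L) ↑Λ)
    (h' : Set.InjOn (Torus.proj (d := d) L) ↑(affShiftSet ε v Λ)) :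
    (siteAffEmb ε v Λ).trans (spinToTorusEmb L h') =
      (spinToTorusEmb L h).trans (torusAff ε (Torus.proj L v)).toEmbedding :=
  DFunLike.ext _ _ fun x => by
    rw [Function.Embedding.trans_apply, Function.Embedding.trans_apply, spinToTorusEmb_apply,
      spinToTorusEmb_apply, Equiv.coe_toEmbedding, coe_siteAffEmb, Torus.proj_affSite]

end SiteMaps

/-! ### The pull-back dictionary in the spin algebra of the torus -/

section Dictionary

variable {d L : ℕ} [NeZero L] {q : ℕ}

/-- `Γ(ι_{Λ'}) (Γ(incl) A) = Γ(ι_Λ) A`. [cite: BratteliRobinsonII1997, §6.2.1] -/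
theorem spinEmbed_toTorus_incl {Λ Λ' : Finset (Site d)} (hΛ : Λ ⊆ Λ')
    (h' : Set.InjOn (Torus.proj (d := d) L) ↑Λ') (A : Op ↥Λ q) :
    spinEmbed (spinToTorusEmb L h') (spinEmbed (siteIncl hΛ) A) =
      spinEmbed (spinToTorusEmb L (h'.mono (by exact_mod_cast hΛ))) A := by
  rw [spinEmbed_spinEmbed, siteIncl_trans_spinToTorusEmb]

/-- **Affine differences in the window become symmetry defects on the torus**:
`Γ(ι_{Λ'})(Γ(incl)(Γ(affEmb ε v) Y) − Γ(incl) Y) = P (Γ(ι_Λ) Y) Pᴴ − Γ(ι_Λ) Y` with `P` the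
permutation unitary of `y ↦ εy + (v mod L)`. Han 2020 §2 (`F[U⁻¹OU] = F[O]`). [cite: Han2020Bootstrap, §2] -/
theorem spinEmbed_toTorus_aff_sub {Λ Λ' : Finset (Site d)} (hΛ : Λ ⊆ Λ') (ε : ℤˣ) (v : Site d)
    (hsh : affShiftSet ε v Λ ⊆ Λ') (h' : Set.InjOn (Torus.proj (d := d) L) ↑Λ') (Y : Op ↥Λ q) :
    spinEmbed (spinToTorusEmb L h')
        (spinEmbed (siteIncl hsh) (spinEmbed (siteAffEmb ε v Λ) Y) - spinEmbed (siteIncl hΛ) Y) =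
      permOp (torusAff ε (Torus.proj L v)) *
          spinEmbed (spinToTorusEmb L (h'.mono (by exact_mod_cast hΛ))) Y *
          (permOp (torusAff ε (Torus.proj L v)))ᴴ -
        spinEmbed (spinToTorusEmb L (h'.mono (by exact_mod_cast hΛ))) Y := by
  rw [map_sub, spinEmbed_toTorus_incl hΛ h', spinEmbed_toTorus_incl hsh h', spinEmbed_spinEmbed,
    siteAffEmb_trans_spinToTorusEmb L ε v (h'.mono (by exact_mod_cast hΛ)) (h'.mono (by exact_mod_cast hsh)),
    permOp_conj_spinEmbed]

/-- **`Γ` preserves Gram forms**: `Γ(Σ Λₐᵦ Oₐᴴ O_b) = Σ Λₐᵦ (Γ Oₐ)ᴴ (Γ O_b)`. [folklore] -/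
theorem spinEmbed_gramForm {X Y : Type*} [Fintype X] [DecidableEq X] [Fintype Y] [DecidableEq Y]
    (φ : X ↪ Y) {m : Type*} [Fintype m] (Λm : Matrix m m ℂ) (O : m → Op X q) :
    spinEmbed φ (gramForm Λm O) = gramForm Λm (fun i => spinEmbed φ (O i)) := by
  simp only [gramForm, map_sum, map_smul, map_mul, star_eq_conjTranspose, spinEmbed_conjTranspose]

open scoped MatrixOrder in
/-- **`Γ` preserves contractions** (`1 − Mᴴ M ⪰ 0` is a `*`-algebraic statement). [folklore] -/
theorem isContraction_spinEmbed {X Y : Type*} [Fintype X] [DecidableEq X] [Fintype Y] [DecidableEq Y]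
    (φ : X ↪ Y) {M : Op X q} (hM : M.IsContraction) : (spinEmbed φ M).IsContraction := by
  classical
  obtain ⟨B, hB⟩ := CStarAlgebra.nonneg_iff_eq_star_mul_self.mp hM.nonneg
  have h : (1 : Op Y q) - (spinEmbed φ M)ᴴ * spinEmbed φ M = (spinEmbed φ B)ᴴ * spinEmbed φ B := by
    rw [← spinEmbed_conjTranspose, ← spinEmbed_conjTranspose, ← map_mul, ← map_mul,
      ← map_one (spinEmbed (q := q) φ), ← map_sub, hB, star_eq_conjTranspose]
  rw [Matrix.IsContraction, h]
  exact Matrix.posSemidef_conjTranspose_mul_self _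

end Dictionary

/-! ### Lattice symmetries and the per-site decomposition of the Heisenberg ring -/

section Torus

variable {d L : ℕ} [NeZero L]

/-- `y ↦ εy + v` is an automorphism of the nearest-neighbour torus graph (torus-site form of
`fermionTorusGraph_adj_torusAff`). [cite: BratteliRobinsonII1997, §6.2.1] -/
theorem torusGraph_adj_torusAff (ε : ℤˣ) (v : TorusSite d L) (x y : TorusSite d L) :
    (torusGraph d L).Adj (torusAff ε v x) (torusAff ε v y) ↔ (torusGraph d L).Adj x y := by
  have h := fermionTorusGraph_adj_torusAff ε v (FermionTorus.ofTorusSite x) (FermionTorus.ofTorusSite y)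
  rwa [fermionTorusGraph_adj, fermionTorusGraph_adj, FermionTorus.toTorusSite_ofTorusEquiv,
    FermionTorus.toTorusSite_ofTorusEquiv, FermionTorus.toTorusSite_ofTorusSite,
    FermionTorus.toTorusSite_ofTorusSite] at h

/-- **Covariance of the Heisenberg Hamiltonian under graph isomorphisms**: relabelling the sites
along a bijection carrying the bonds of `G` onto those of `G'` carries `H_G` to `H_{G'}`.
Tasaki (2020) §2.4, eq. (2.4.1). [cite: Tasaki2020, §2.4] -/
theorem reindexOp_heisenbergHamiltonian {V W : Type*} [Fintype V] [DecidableEq V] [Fintype W]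
    [DecidableEq W] (n : ℕ) (G : SimpleGraph V) [DecidableRel G.Adj] (G' : SimpleGraph W)
    [DecidableRel G'.Adj] (e : V ≃ W) (hadj : ∀ x y, G'.Adj (e x) (e y) ↔ G.Adj x y) (J : ℝ) :
    reindexOp e (heisenbergHamiltonian n G J) = heisenbergHamiltonian n G' J := by
  unfold heisenbergHamiltonian
  rw [map_smul, map_sum]
  congr 1
  refine Finset.sum_nbij (Sym2.map e) ?_ ?_ ?_ ?_
  · intro s hs
    induction s using Sym2.ind with
    | _ x y =>
      rw [SimpleGraph.mem_edgeFinset, SimpleGraph.mem_edgeSet] at hs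
      rw [Sym2.map_mk, SimpleGraph.mem_edgeFinset, SimpleGraph.mem_edgeSet]
      exact (hadj x y).2 hs
  · exact fun s _ s' _ h => Sym2.map.injective e.injective h
  · intro s' hs'
    refine ⟨Sym2.map e.symm s', ?_, by rw [Sym2.map_map]; simp⟩
    induction s' using Sym2.ind with
    | _ x y =>
      rw [Finset.mem_coe, SimpleGraph.mem_edgeFinset, SimpleGraph.mem_edgeSet] at hs'
      rw [Sym2.map_mk, Finset.mem_coe, SimpleGraph.mem_edgeFinset, SimpleGraph.mem_edgeSet,
        ← hadj, Equiv.apply_symm_apply, Equiv.apply_symm_apply]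
      exact hs'
  · intro s _
    induction s using Sym2.ind with
    | _ x y => rw [Sym2.map_mk, spinDotSym_mk, spinDotSym_mk, reindexOp_spinDot]

/-- **Invariance of the Heisenberg Hamiltonian of the torus under `y ↦ εy + v`** (translations
and reflections). [cite: Tasaki2020, §2.4] -/
theorem reindexOp_torusAff_heisenbergHamiltonian (n : ℕ) (ε : ℤˣ) (v : TorusSite d L) (J : ℝ) :
    reindexOp (torusAff ε v) (heisenbergHamiltonian n (torusGraph d L) J) =
      heisenbergHamiltonian n (torusGraph d L) J :=
  reindexOp_heisenbergHamiltonian n _ _ (torusAff ε v) (torusGraph_adj_torusAff ε v) J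

/-- The permutation unitary of `y ↦ εy + v` commutes with the Heisenberg Hamiltonian of the torus.
[cite: Tasaki2020, §2.4] -/
theorem permOp_torusAff_mul_heisenbergHamiltonian (n : ℕ) (ε : ℤˣ) (v : TorusSite d L) (J : ℝ) :
    permOp (torusAff ε v) * heisenbergHamiltonian n (torusGraph d L) J =
      heisenbergHamiltonian n (torusGraph d L) J * permOp (torusAff ε v) :=
  (permOp_mul_eq_mul_permOp_iff _ _).2 (reindexOp_torusAff_heisenbergHamiltonian n ε v J)

/-- Undoing a relabelling. [folklore] -/
theorem reindexOp_symm_reindexOp {V W : Type*} [Fintype V] [DecidableEq V] [Fintype W]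
    [DecidableEq W] {q : ℕ} (e : V ≃ W) (A : Op V q) : reindexOp e.symm (reindexOp e A) = A := by
  ext σ τ
  simp [reindexOp_apply]

/-- **The per-site decomposition of the Heisenberg ring**: for `L ≥ 3`,
`Σ_{v ∈ ℤ/Lℤ} P_v (𝐒_0 · 𝐒_{e₀}) P_vᴴ = Σ_{bonds} 𝐒_x · 𝐒_y = H_L(J = 1)` with `P_v` the translation
unitaries (the tree's `heisenbergRing_eq_heisenbergHamiltonian_torusGraph_holds`, transported to
`Fin 1 → ℤ/Lℤ`). Tasaki (2020) §2.4, eq. (2.4.1). [cite: Tasaki2020, §2.4] -/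
theorem sum_permOp_conj_spinDot (n : ℕ) (hL : 3 ≤ L) :
    ∑ v : TorusSite 1 L, permOp (torusAff 1 v) *
        spinDot n (Torus.proj L (0 : Site 1)) (Torus.proj L (unitVec 0 : Site 1)) * (permOp (torusAff 1 v))ᴴ =
      heisenbergHamiltonian n (torusGraph 1 L) 1 := by
  set f := Equiv.funUnique (Fin 1) (ZMod L) with hf
  have hring := heisenbergRing_eq_heisenbergHamiltonian_torusGraph_holds n L hL
  have hH : heisenbergHamiltonian n (torusGraph 1 L) 1 = reindexOp f.symm (heisenbergRing L n) := by
    rw [hring, reindexOp_symm_reindexOp]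
  rw [hH, heisenbergRing, map_sum, ← Fintype.sum_equiv f.symm _ _ (fun _ => rfl)]
  refine Fintype.sum_congr _ _ fun i => ?_
  rw [permOp_mul_mul_conjTranspose, reindexOp_spinDot, reindexOp_spinDot, torusAff_one,
    Equiv.coe_addRight, torusProj_unitVec]
  have h0 : Torus.proj L (0 : Site 1) = 0 := by funext j; simp [Torus.proj]
  have hc : ∀ a : ZMod L, f.symm a = fun _ => a := fun a => rfl
  rw [h0]
  beta_reduce
  rw [zero_add, hc, hc]
  congr 1
  funext j
  rw [Pi.add_apply, Subsingleton.elim j 0, Pi.single_eq_same, add_comm]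

end Torus

/-! ### The nearest-neighbour graph of a window and the commutator pull-back -/

section Commutator

variable {d L : ℕ} [NeZero L]

/-- The nearest-neighbour graph of the window `Λ' ⊆ ℤ^d` (bonds `{x, x + eᵢ} ⊆ Λ'`; free boundary
conditions). Tasaki (2020) §2.4 (bond set `ℬ`). [cite: Tasaki2020, §2.4] -/
def windowGraph (Λ' : Finset (Site d)) : SimpleGraph ↥Λ' :=
  SimpleGraph.fromRel fun x y : ↥Λ' => ∃ i : Fin d, (y : Site d) = x + unitVec i

/-- Adjacency in the window graph. [folklore] -/
theorem windowGraph_adj {Λ' : Finset (Site d)} (x y : ↥Λ') :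
    (windowGraph Λ').Adj x y ↔
      x ≠ y ∧ ((∃ i : Fin d, (y : Site d) = x + unitVec i) ∨ ∃ i : Fin d, (x : Site d) = y + unitVec i) := by
  unfold windowGraph
  exact SimpleGraph.fromRel_adj _ _ _

/-- Adjacency in the window graph is decidable (via `windowGraph_adj`). [folklore] -/
instance windowGraph.instDecidableRel (Λ' : Finset (Site d)) : DecidableRel (windowGraph Λ').Adj :=
  fun x y => decidable_of_iff
    (x ≠ y ∧ ((∃ i : Fin d, (y : Site d) = x + unitVec i) ∨ ∃ i : Fin d, (x : Site d) = y + unitVec i))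
    (windowGraph_adj x y).symm

/-- `{x, x + eᵢ}` is a bond of the window when both sites lie in it. [folklore] -/
theorem windowGraph_adj_add_unitVec {Λ' : Finset (Site d)} {x : Site d} (hx : x ∈ Λ') (i : Fin d)
    (hxi : x + unitVec i ∈ Λ') : (windowGraph Λ').Adj ⟨x, hx⟩ ⟨x + unitVec i, hxi⟩ := by
  rw [windowGraph_adj]
  refine ⟨fun h => self_ne_add_unitVec x i (congrArg Subtype.val h), Or.inl ⟨i, rfl⟩⟩

/-- `{x − eᵢ, x}` is a bond of the window when both sites lie in it. [folklore] -/
theorem windowGraph_adj_sub_unitVec {Λ' : Finset (Site d)} {x : Site d} (hx : x ∈ Λ') (i : Fin d)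
    (hxi : x - unitVec i ∈ Λ') : (windowGraph Λ').Adj ⟨x, hx⟩ ⟨x - unitVec i, hxi⟩ := by
  rw [windowGraph_adj]
  refine ⟨fun h => self_ne_add_unitVec (x - unitVec i) i ?_, Or.inr ⟨i, (sub_add_cancel x _).symm⟩⟩
  have h' : x = x - unitVec i := congrArg Subtype.val h
  rw [sub_add_cancel]; exact h'.symm

omit [NeZero L] in
/-- **Window bonds are pulled back to torus bonds** (when `x ↦ x mod L` is injective on the
window). [cite: BratteliRobinsonII1997, §6.2.1] -/
theorem torusGraph_adj_of_windowGraph_adj {Λ' : Finset (Site d)}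
    (h' : Set.InjOn (Torus.proj (d := d) L) ↑Λ') {x y : ↥Λ'} (hxy : (windowGraph Λ').Adj x y) :
    (torusGraph d L).Adj (Torus.proj L (x : Site d)) (Torus.proj L (y : Site d)) := by
  rw [windowGraph_adj] at hxy
  rw [torusGraph_adj_iff]
  refine ⟨fun h => hxy.1 (Subtype.ext (h' x.2 y.2 h)), ?_⟩
  rcases hxy.2 with ⟨i, hi⟩ | ⟨i, hi⟩
  · exact Or.inl ⟨i, by rw [hi, torusProj_add, torusProj_unitVec]⟩
  · exact Or.inr ⟨i, by rw [hi, torusProj_add, torusProj_unitVec]⟩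

/-- `𝐒_x · 𝐒_y` is supported on `{x, y}`. [cite: NachtergaeleSims2006, §2] -/
theorem isSupportedOn_spinDot {V : Type*} [Fintype V] [DecidableEq V] (n : ℕ) (x y : V) :
    IsSupportedOn (spinDot n x y) ({x, y} : Finset V) := by
  have hx : ∀ α, IsSupportedOn (siteSpin n x α : Op V (n + 1)) ({x, y} : Finset V) := fun α =>
    IsSupportedOn.mono_holds (isSupportedOn_onSite_holds x _) (by simp)
  have hy : ∀ α, IsSupportedOn (siteSpin n y α : Op V (n + 1)) ({x, y} : Finset V) := fun α =>
    IsSupportedOn.mono_holds (isSupportedOn_onSite_holds y _) (by simp)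
  unfold spinDot spinBond
  exact IsSupportedOn.sum _ fun α _ => IsSupportedOn.smul
    (IsSupportedOn.add (IsSupportedOn.mul_holds (hx α) (hy α)) (IsSupportedOn.mul_holds (hy α) (hx α))) _

/-- `Γ_φ (𝐒_x · 𝐒_y as a bond operator) = the bond operator of the image bond`. [folklore] -/
theorem spinEmbed_spinDotSym {X Y : Type*} [Fintype X] [DecidableEq X] [Fintype Y] [DecidableEq Y]
    (φ : X ↪ Y) (n : ℕ) (s : Sym2 X) :
    spinEmbed φ (spinDotSym n s : Op X (n + 1)) = spinDotSym n (Sym2.map φ s) := by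
  induction s using Sym2.ind with
  | _ x y => rw [Sym2.map_mk, spinDotSym_mk, spinDotSym_mk, spinEmbed_spinDot]

/-- **The commutator pull-back for the Heisenberg model**: for `B` living on an inner region `Λ`
all of whose lattice neighbours lie in the window `Λ'` (and `x ↦ x mod L` injective on `Λ'`),
`[H_L, Γ(ι_{Λ'})(Γ(incl) B)] = Γ(ι_{Λ'}) [H_{Λ'}, Γ(incl) B]` — the bonds of the ring not coming from
window bonds do not touch the image of `Λ`. Han 2020 §2 (`F[[H,O]] = 0` evaluated locally);
Bratteli–Robinson II §6.2.1 (local commutativity). [cite: Han2020Bootstrap, §2] -/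
theorem heisenbergTorus_commutator_spinEmbed (n : ℕ) (J : ℝ) {Λ Λ' : Finset (Site d)} (hΛ : Λ ⊆ Λ')
    (hclosed : ∀ x ∈ Λ, ∀ i : Fin d, x + unitVec i ∈ Λ' ∧ x - unitVec i ∈ Λ')
    (h' : Set.InjOn (Torus.proj (d := d) L) ↑Λ') (B : Op ↥Λ (n + 1)) :
    heisenbergHamiltonian n (torusGraph d L) J *
          spinEmbed (spinToTorusEmb L h') (spinEmbed (siteIncl hΛ) B) -
        spinEmbed (spinToTorusEmb L h') (spinEmbed (siteIncl hΛ) B) *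
          heisenbergHamiltonian n (torusGraph d L) J =
      spinEmbed (spinToTorusEmb L h')
        (heisenbergHamiltonian n (windowGraph Λ') J * spinEmbed (siteIncl hΛ) B -
          spinEmbed (siteIncl hΛ) B * heisenbergHamiltonian n (windowGraph Λ') J) := by
  classical
  set φ := spinToTorusEmb L h' with hφ
  set ψ : Sym2 ↥Λ' → Sym2 (TorusSite d L) := Sym2.map φ with hψ
  set E := (torusGraph d L).edgeFinset with hE
  set Ew := (windowGraph Λ').edgeFinset with hEw
  set I := Ew.image ψ with hI
  set ΓB := spinEmbed φ (spinEmbed (siteIncl hΛ) B) with hΓB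
  -- (1) the window Hamiltonian is pulled back to the sum over the image bonds
  have hψinj : ∀ e ∈ Ew, ∀ e' ∈ Ew, ψ e = ψ e' → e = e' :=
    fun e _ e' _ h => Sym2.map.injective φ.injective h
  have hHw : spinEmbed φ (heisenbergHamiltonian n (windowGraph Λ') J) = (J : ℂ) • ∑ e' ∈ I, spinDotSym n e' := by
    unfold heisenbergHamiltonian
    rw [map_smul, map_sum, hI, Finset.sum_image hψinj]
    exact congrArg _ (Finset.sum_congr rfl fun e _ => spinEmbed_spinDotSym φ n e)
  -- (2) image bonds are torus bonds
  have hIE : I ⊆ E := by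
    intro e' he'
    obtain ⟨e, he, rfl⟩ := Finset.mem_image.1 he'
    induction e using Sym2.ind with
    | _ x y =>
      rw [hEw, SimpleGraph.mem_edgeFinset, SimpleGraph.mem_edgeSet] at he
      rw [hψ, Sym2.map_mk, hE, SimpleGraph.mem_edgeFinset, SimpleGraph.mem_edgeSet]
      exact torusGraph_adj_of_windowGraph_adj h' he
  -- (3) the remaining torus bonds do not touch the image of `Λ`
  have hΓB' : ΓB = spinEmbed (spinToTorusEmb L (h'.mono (by exact_mod_cast hΛ))) B := by
    rw [hΓB, hφ, spinEmbed_toTorus_incl]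
  have hfar : ∀ e' ∈ E \ I, Commute ΓB (spinDotSym n e') := by
    intro e' he'
    rw [Finset.mem_sdiff] at he'
    obtain ⟨heE, heI⟩ := he'
    induction e' using Sym2.ind with
    | _ x' y' =>
      rw [hE, SimpleGraph.mem_edgeFinset, SimpleGraph.mem_edgeSet] at heE
      rw [spinDotSym_mk, hΓB']
      refine spinEmbed_commute_of_disjoint _ B (isSupportedOn_spinDot n x' y') ?_
      rw [Finset.disjoint_iff_ne]
      rintro z hz _ hz' rfl
      -- `z = proj x` with `x ∈ Λ`, and `z ∈ {x', y'}`: the bond comes from a window bond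
      rw [rangeSites, Finset.mem_map] at hz
      obtain ⟨⟨x, hx⟩, -, hxz⟩ := hz
      rw [spinToTorusEmb_apply] at hxz
      apply heI
      rw [hI, Finset.mem_image]
      -- the torus neighbour of `proj x` in the bond
      have key : ∀ {a b : TorusSite d L}, (torusGraph d L).Adj a b → a = Torus.proj L x →
          ∃ e ∈ Ew, ψ e = s(a, b) := by
        intro a b hab ha
        rw [torusGraph_adj_iff] at hab
        rcases hab.2 with ⟨i, hi⟩ | ⟨i, hi⟩
        · refine ⟨s(⟨x, hΛ hx⟩, ⟨x + unitVec i, (hclosed x hx i).1⟩), ?_, ?_⟩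
          · rw [hEw, SimpleGraph.mem_edgeFinset, SimpleGraph.mem_edgeSet]
            exact windowGraph_adj_add_unitVec (hΛ hx) i _
          · rw [hψ, Sym2.map_mk, hφ, spinToTorusEmb_apply, spinToTorusEmb_apply]
            simp only
            rw [torusProj_add, torusProj_unitVec, ← ha, ← hi]
        · refine ⟨s(⟨x, hΛ hx⟩, ⟨x - unitVec i, (hclosed x hx i).2⟩), ?_, ?_⟩
          · rw [hEw, SimpleGraph.mem_edgeFinset, SimpleGraph.mem_edgeSet]
            exact windowGraph_adj_sub_unitVec (hΛ hx) i _
          · rw [hψ, Sym2.map_mk, hφ, spinToTorusEmb_apply, spinToTorusEmb_apply]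
            simp only
            have hb : b = Torus.proj L (x - unitVec i) := by
              rw [sub_eq_add_neg, torusProj_add, ← ha, hi]
              have hneg : Torus.proj L (-(unitVec i : Site d)) = -Pi.single i 1 := by
                rw [← torusProj_unitVec L i]; funext j; simp [Torus.proj]
              rw [hneg, add_neg_cancel_right]
            rw [← ha, hb]
      rcases Finset.mem_insert.1 hz' with rfl | hz''
      · exact key heE hxz.symm
      · rw [Finset.mem_singleton] at hz''
        subst hz''
        obtain ⟨e, he, hee⟩ := key heE.symm hxz.symm
        exact ⟨e, he, by rw [hee, Sym2.eq_swap]⟩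
  -- (4) assemble
  have hsplit : heisenbergHamiltonian n (torusGraph d L) J =
      (J : ℂ) • ∑ e' ∈ I, spinDotSym n e' + (J : ℂ) • ∑ e' ∈ E \ I, spinDotSym n e' := by
    unfold heisenbergHamiltonian
    rw [← hE, ← smul_add, ← Finset.sum_sdiff hIE]
    exact congrArg _ (add_comm _ _)
  have hcomm : ((J : ℂ) • ∑ e' ∈ E \ I, spinDotSym n e') * ΓB = ΓB * ((J : ℂ) • ∑ e' ∈ E \ I, spinDotSym n e') := by
    rw [smul_mul_assoc, mul_smul_comm, Finset.sum_mul, Finset.mul_sum]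
    exact congrArg _ (Finset.sum_congr rfl fun e' he' => ((hfar e' he').eq).symm)
  rw [hsplit, add_mul, mul_add, hcomm, add_sub_add_right_eq_sub, ← hHw, ← map_mul, ← map_mul, ← map_sub]

end Commutator

/-! ### The `S^z` charge: total spin of the torus versus total spin of the window -/

section Charge

variable {X Y : Type*} [Fintype X] [DecidableEq X] [Fintype Y] [DecidableEq Y]

/-- The total spin of `Y` is the embedded total spin of `X` plus the spins off the range of `φ`.
[cite: Tasaki2020, §2.5] -/
theorem totalSpin_eq_spinEmbed_add (φ : X ↪ Y) (n : ℕ) (α : Fin 3) :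
    (totalSpin n α : Op Y (n + 1)) =
      spinEmbed φ (totalSpin n α) + ∑ y ∈ (rangeSites φ)ᶜ, siteSpin n y α := by
  unfold totalSpin
  rw [map_sum, ← Finset.sum_add_sum_compl (rangeSites φ)]
  congr 1
  rw [rangeSites, Finset.sum_map]
  exact Finset.sum_congr rfl fun x _ => (spinEmbed_siteSpin φ n x α).symm

/-- **`[S^α_tot, Γ_φ W] = Γ_φ [S^α_X, W]`**: the spins off the range of `φ` commute with embedded
operators. [cite: Tasaki2020, §2.5] -/
theorem totalSpin_commutator_spinEmbed (φ : X ↪ Y) (n : ℕ) (α : Fin 3) (W : Op X (n + 1)) :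
    totalSpin n α * spinEmbed φ W - spinEmbed φ W * totalSpin n α =
      spinEmbed φ (totalSpin n α * W - W * totalSpin n α) := by
  have hR : Commute (spinEmbed φ W) (∑ y ∈ (rangeSites φ)ᶜ, (siteSpin n y α : Op Y (n + 1))) := by
    refine Commute.sum_right _ _ _ fun y hy => ?_
    refine spinEmbed_commute_of_disjoint φ W (isSupportedOn_onSite_holds y _) ?_
    rw [Finset.mem_compl] at hy
    exact Finset.disjoint_singleton_right.2 hy
  rw [totalSpin_eq_spinEmbed_add φ n α, add_mul, mul_add, hR.eq, add_sub_add_right_eq_sub,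
    map_sub, map_mul, map_mul]

end Charge

/-! ### The window certificate for the Heisenberg chain -/

section Window

variable {L : ℕ} [NeZero L]

/-- `H(J) = J • H(1)`. [folklore] -/
theorem heisenbergHamiltonian_eq_smul_one {V : Type*} [Fintype V] [DecidableEq V] (n : ℕ)
    (G : SimpleGraph V) [DecidableRel G.Adj] (J : ℝ) :
    heisenbergHamiltonian n G J = (J : ℂ) • heisenbergHamiltonian n G 1 := by
  simp only [heisenbergHamiltonian, Complex.ofReal_one, one_smul]

/-- **Window certificate ⇒ ground-state energy of EVERY long Heisenberg ring.** Data: a window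
`Λ' ⊆ ℤ` containing `0, 1` (so that the energy density `J 𝐒_0 · 𝐒_1` lives in it) and an inner region
`Λ ⊆ Λ'` all of whose lattice neighbours lie in `Λ'`; an identity in `𝔄_{Λ'} = Op ↥Λ' (n+1)`
`J 𝐒_0·𝐒_1 − c·1 = Σ Λₐᵦ Oₐᴴ O_b + (Σₖ (H_{Λ'} Γ(incl)Bₖ − Γ(incl)Bₖ H_{Λ'})
   + Σₗ (Γ(incl)(Γ(affEmb εₗ vₗ) Yₗ) − Γ(incl) Yₗ) + Σⱼ bⱼ • Wⱼ) + (Σₘ dₘ • (Vₘᴴ − Vₘ) + Σₖ aₖ • Mₖ)`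
with `Λ ⪰ 0`, `H_{Λ'}` the free-boundary Heisenberg Hamiltonian of the window (`windowGraph`),
`Bₖ, Yₗ ∈ 𝔄_Λ`, affine maps `x ↦ εₗx + vₗ` (`εₗ = ±1`: translations and reflections) with
`εₗΛ + vₗ ⊆ Λ'`, `S^z`-CHARGED `Wⱼ` (`[S^z_{Λ'}, Wⱼ] = mⱼ Wⱼ`, `mⱼ ≠ 0`), real `dₘ`, contractions
`Mₖ`. Then for every ring length `L ≥ 3` with `x ↦ x mod L` injective on `Λ'`:
`(c − Σₖ ‖aₖ‖) · L ≤ E₀(H_L)`, `H_L = J Σ_{bonds of ℤ/Lℤ} 𝐒_x · 𝐒_y`. Han 2020 §2 (spin-chain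
bootstrap in the thermodynamic limit: positivity, `F[[H,O]] = 0`, `F[U⁻¹OU] = F[O]`, charge
conservation), read on the ring through its tracial ground state. [cite: Han2020Bootstrap, §2] -/
theorem heisenbergChain_groundEnergy_ge_of_window_certificate (n : ℕ) (J : ℝ) (hL : 3 ≤ L)
    {Λ Λ' : Finset (Site 1)} (hΛ : Λ ⊆ Λ')
    (hclosed : ∀ x ∈ Λ, ∀ i : Fin 1, x + unitVec i ∈ Λ' ∧ x - unitVec i ∈ Λ')
    (hz : (0 : Site 1) ∈ Λ') (he : (unitVec 0 : Site 1) ∈ Λ')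
    (hInj : Set.InjOn (Torus.proj (d := 1) L) ↑Λ')
    {m : Type*} [Fintype m] [DecidableEq m] {Λm : Matrix m m ℂ} (hΛm : Λm.PosSemidef)
    (O : m → Op ↥Λ' (n + 1))
    {κ : Type*} (s : Finset κ) (B : κ → Op ↥Λ (n + 1))
    {ι : Type*} (tt : Finset ι) (ε : ι → ℤˣ) (v : ι → Site 1)
    (hsh : ∀ l, affShiftSet (ε l) (v l) Λ ⊆ Λ') (Y : ι → Op ↥Λ (n + 1))
    {ρ : Type*} (u : Finset ρ) (b : ρ → ℂ) (W : ρ → Op ↥Λ' (n + 1)) (mq : ρ → ℂ)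
    (hmq : ∀ j ∈ u, mq j ≠ 0)
    (hW : ∀ j ∈ u, totalSpin n 2 * W j - W j * totalSpin n 2 = mq j • W j)
    {δ : Type*} (ah : Finset δ) (dc : δ → ℝ) (V : δ → Op ↥Λ' (n + 1))
    {κ'' : Type*} (w : Finset κ'') (a : κ'' → ℂ) (M : κ'' → Op ↥Λ' (n + 1))
    (hM : ∀ k ∈ w, (M k).IsContraction) {c : ℝ}
    (hcert : (J : ℂ) • spinDot n (⟨0, hz⟩ : ↥Λ') ⟨unitVec 0, he⟩ - (c : ℂ) • (1 : Op ↥Λ' (n + 1)) =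
      gramForm Λm O +
        (∑ k ∈ s, (heisenbergHamiltonian n (windowGraph Λ') J * spinEmbed (siteIncl hΛ) (B k) -
            spinEmbed (siteIncl hΛ) (B k) * heisenbergHamiltonian n (windowGraph Λ') J) +
          ∑ l ∈ tt, (spinEmbed (siteIncl (hsh l)) (spinEmbed (siteAffEmb (ε l) (v l) Λ) (Y l)) -
            spinEmbed (siteIncl hΛ) (Y l)) +
          ∑ j ∈ u, b j • W j) +
        (∑ m' ∈ ah, ((dc m' : ℝ) : ℂ) • ((V m')ᴴ - V m') + ∑ k ∈ w, a k • M k)) :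
    (c - ∑ k ∈ w, ‖a k‖) * L ≤ (heisenbergHamiltonian n (torusGraph 1 L) J).groundEnergy := by
  classical
  have hInjΛ : Set.InjOn (Torus.proj (d := 1) L) ↑Λ := hInj.mono (by exact_mod_cast hΛ)
  set Γ' := spinEmbed (q := n + 1) (spinToTorusEmb L hInj) with hΓ'
  set ΓΛ := spinEmbed (q := n + 1) (spinToTorusEmb L hInjΛ) with hΓΛ
  set H := heisenbergHamiltonian n (torusGraph 1 L) J with hH
  have hHh : H.IsHermitian := heisenbergHamiltonian_isHermitian n _ J
  set X := Γ' ((J : ℂ) • spinDot n (⟨0, hz⟩ : ↥Λ') ⟨unitVec 0, he⟩) with hX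
  have hXe : X = (J : ℂ) • spinDot n (Torus.proj L (0 : Site 1)) (Torus.proj L (unitVec 0 : Site 1)) := by
    rw [hX, map_smul, hΓ', spinEmbed_spinDot, spinToTorusEmb_apply, spinToTorusEmb_apply]
  -- translations
  set T : TorusSite 1 L → Op (TorusSite 1 L) (n + 1) := fun v' => permOp (torusAff 1 v') with hT
  have hTH : ∀ v', T v' * H = H * T v' := fun v' => permOp_torusAff_mul_heisenbergHamiltonian n 1 v' J
  have hTT : ∀ v', (T v')ᴴ * T v' = 1 := fun v' => conjTranspose_permOp_mul _
  have hsum : ∑ v', T v' * X * (T v')ᴴ = H := by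
    rw [hXe, hH, heisenbergHamiltonian_eq_smul_one n (torusGraph 1 L) J, ← sum_permOp_conj_spinDot n hL,
      Finset.smul_sum]
    refine Finset.sum_congr rfl fun v' _ => ?_
    rw [hT]
    simp only [Matrix.mul_smul, Matrix.smul_mul]
  -- the sector is the whole space
  have hK : (⊤ : Submodule ℂ (TensorIndex (TorusSite 1 L) (n + 1) → ℂ)) ≠ ⊥ := top_ne_bot
  -- symmetry family
  set Us : ι → Op (TorusSite 1 L) (n + 1) := fun l => permOp (torusAff (ε l) (Torus.proj L (v l))) with hUs
  set Yt : ι → Op (TorusSite 1 L) (n + 1) := fun l => ΓΛ (Y l) with hYt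
  have hU : ∀ l ∈ tt, Us l * H = H * Us l := fun l _ => permOp_torusAff_mul_heisenbergHamiltonian n _ _ J
  have hUU : ∀ l ∈ tt, (Us l)ᴴ * Us l = 1 := fun l _ => conjTranspose_permOp_mul _
  -- charge family
  set C : ρ → Op (TorusSite 1 L) (n + 1) := fun _ => totalSpin n 2 with hC
  set Wt : ρ → Op (TorusSite 1 L) (n + 1) := fun j => (b j / mq j) • Γ' (W j) with hWt
  have hCH : ∀ j ∈ u, C j * H = H * C j := fun _ _ =>
    (commute_heisenbergHamiltonian_totalSpin n (torusGraph 1 L) J 2).symm.eq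
  have hcharged : ∀ j ∈ u, Γ' (b j • W j) = C j * Wt j - Wt j * C j := by
    intro j hj
    rw [hC, hWt]
    simp only [Matrix.mul_smul, Matrix.smul_mul]
    rw [← smul_sub, hΓ', totalSpin_commutator_spinEmbed, hW j hj, map_smul, map_smul, smul_smul,
      div_mul_cancel₀ _ (hmq j hj)]
  -- residual
  have hMt : ∀ k ∈ w, (Γ' (M k)).IsContraction := fun k hk => isContraction_spinEmbed _ (hM k hk)
  -- the identity on the torus
  have htorus : X - (c : ℂ) • (1 : Op (TorusSite 1 L) (n + 1)) =
      gramForm Λm (fun i => Γ' (O i)) +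
        (∑ k ∈ s, (H * Γ' (spinEmbed (siteIncl hΛ) (B k)) - Γ' (spinEmbed (siteIncl hΛ) (B k)) * H) +
          ∑ l ∈ tt, (Us l * Yt l * (Us l)ᴴ - Yt l) +
          ∑ i ∈ (∅ : Finset (Fin 0)), ((0 : Op (TorusSite 1 L) (n + 1)) *
              ((0 : Op (TorusSite 1 L) (n + 1)) - (((0 : ℝ) : ℝ) : ℂ) • 1) +
            ((0 : Op (TorusSite 1 L) (n + 1)) - (((0 : ℝ) : ℝ) : ℂ) • 1) * (0 : Op (TorusSite 1 L) (n + 1))) +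
          ∑ j ∈ u, (C j * Wt j - Wt j * C j)) +
        (∑ m' ∈ ah, ((dc m' : ℝ) : ℂ) • ((Γ' (V m'))ᴴ - Γ' (V m')) + ∑ k ∈ w, a k • Γ' (M k)) := by
    have key := congrArg Γ' hcert
    rw [map_sub, map_smul Γ' ((c : ℝ) : ℂ) (1 : Op ↥Λ' (n + 1)), map_one] at key
    have h1 : Γ' (∑ k ∈ s, (heisenbergHamiltonian n (windowGraph Λ') J * spinEmbed (siteIncl hΛ) (B k) -
        spinEmbed (siteIncl hΛ) (B k) * heisenbergHamiltonian n (windowGraph Λ') J)) =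
        ∑ k ∈ s, (H * Γ' (spinEmbed (siteIncl hΛ) (B k)) - Γ' (spinEmbed (siteIncl hΛ) (B k)) * H) := by
      rw [map_sum]
      refine Finset.sum_congr rfl fun k _ => ?_
      rw [hH, hΓ', heisenbergTorus_commutator_spinEmbed n J hΛ hclosed hInj (B k)]
    have h2 : Γ' (∑ l ∈ tt, (spinEmbed (siteIncl (hsh l)) (spinEmbed (siteAffEmb (ε l) (v l) Λ) (Y l)) -
        spinEmbed (siteIncl hΛ) (Y l))) = ∑ l ∈ tt, (Us l * Yt l * (Us l)ᴴ - Yt l) := by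
      rw [map_sum]
      refine Finset.sum_congr rfl fun l _ => ?_
      rw [hUs, hYt, hΓΛ, hΓ']
      exact spinEmbed_toTorus_aff_sub hΛ (ε l) (v l) (hsh l) hInj (Y l)
    have h3 : Γ' (∑ j ∈ u, b j • W j) = ∑ j ∈ u, (C j * Wt j - Wt j * C j) := by
      rw [map_sum]
      exact Finset.sum_congr rfl hcharged
    have h4 : Γ' (∑ m' ∈ ah, ((dc m' : ℝ) : ℂ) • ((V m')ᴴ - V m')) =
        ∑ m' ∈ ah, ((dc m' : ℝ) : ℂ) • ((Γ' (V m'))ᴴ - Γ' (V m')) := by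
      rw [map_sum]
      refine Finset.sum_congr rfl fun m' _ => ?_
      rw [map_smul, map_sub, hΓ', spinEmbed_conjTranspose]
    have h5 : Γ' (∑ k ∈ w, a k • M k) = ∑ k ∈ w, a k • Γ' (M k) := by
      rw [map_sum]
      exact Finset.sum_congr rfl fun k _ => by rw [map_smul]
    rw [hX, key, map_add, map_add, map_add, map_add, map_add, hΓ', spinEmbed_gramForm, ← hΓ', h1, h2, h3,
      h4, h5, Finset.sum_empty, add_zero]
  have hmain := Matrix.mul_card_le_minEnergyOn_of_local_certificate hHh ⊤ (fun _ _ => Submodule.mem_top) hK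
    X T hTH (fun _ _ _ => Submodule.mem_top) (fun _ _ _ => Submodule.mem_top) hTT hsum hΛm
    (fun i => Γ' (O i)) s (fun k => Γ' (spinEmbed (siteIncl hΛ) (B k))) tt Us Yt hU
    (fun _ _ _ _ => Submodule.mem_top) (fun _ _ _ _ => Submodule.mem_top) hUU
    (∅ : Finset (Fin 0)) (fun _ => 0) (fun _ => 0) (fun _ => 0) (fun _ => 0)
    (fun i hi => absurd hi (Finset.notMem_empty i)) (fun i hi => absurd hi (Finset.notMem_empty i))
    u C Wt hCH (fun _ _ _ _ => Submodule.mem_top) (fun _ _ _ _ => Submodule.mem_top)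
    ah dc (fun m' => Γ' (V m')) w a (fun k => Γ' (M k)) hMt htorus
  have hcard : Fintype.card (TorusSite 1 L) = L := by simp [ZMod.card]
  rw [hcard, Matrix.minEnergyOn_top_holds hHh] at hmain
  exact hmain

/-- **Per-site form, in the shape of the bundle's ring-wise thermodynamic-limit rows**
(`HubbardCertifiedBounds.sdp_lower_TL_<heisenberg row>`: `q ≤ E₀(H_L)/L` for every `L ≥ L₀`): with
the data of `heisenbergChain_groundEnergy_ge_of_window_certificate`,
`c − Σₖ ‖aₖ‖ ≤ groundEnergy (heisenbergHamiltonian n (torusGraph 1 L) J) / L` for every `L ≥ 3` with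
`x ↦ x mod L` injective on `Λ'` (for all `L ≥ spread(Λ') + 1`; cf.
`injOn_proj_thicken_one_of_spread`). [cite: Han2020Bootstrap, §2] -/
theorem heisenbergChain_groundEnergy_div_ge_of_window_certificate (n : ℕ) (J : ℝ) (hL : 3 ≤ L)
    {Λ Λ' : Finset (Site 1)} (hΛ : Λ ⊆ Λ')
    (hclosed : ∀ x ∈ Λ, ∀ i : Fin 1, x + unitVec i ∈ Λ' ∧ x - unitVec i ∈ Λ')
    (hz : (0 : Site 1) ∈ Λ') (he : (unitVec 0 : Site 1) ∈ Λ')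
    (hInj : Set.InjOn (Torus.proj (d := 1) L) ↑Λ')
    {m : Type*} [Fintype m] [DecidableEq m] {Λm : Matrix m m ℂ} (hΛm : Λm.PosSemidef)
    (O : m → Op ↥Λ' (n + 1))
    {κ : Type*} (s : Finset κ) (B : κ → Op ↥Λ (n + 1))
    {ι : Type*} (tt : Finset ι) (ε : ι → ℤˣ) (v : ι → Site 1)
    (hsh : ∀ l, affShiftSet (ε l) (v l) Λ ⊆ Λ') (Y : ι → Op ↥Λ (n + 1))
    {ρ : Type*} (u : Finset ρ) (b : ρ → ℂ) (W : ρ → Op ↥Λ' (n + 1)) (mq : ρ → ℂ)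
    (hmq : ∀ j ∈ u, mq j ≠ 0)
    (hW : ∀ j ∈ u, totalSpin n 2 * W j - W j * totalSpin n 2 = mq j • W j)
    {δ : Type*} (ah : Finset δ) (dc : δ → ℝ) (V : δ → Op ↥Λ' (n + 1))
    {κ'' : Type*} (w : Finset κ'') (a : κ'' → ℂ) (M : κ'' → Op ↥Λ' (n + 1))
    (hM : ∀ k ∈ w, (M k).IsContraction) {c : ℝ}
    (hcert : (J : ℂ) • spinDot n (⟨0, hz⟩ : ↥Λ') ⟨unitVec 0, he⟩ - (c : ℂ) • (1 : Op ↥Λ' (n + 1)) =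
      gramForm Λm O +
        (∑ k ∈ s, (heisenbergHamiltonian n (windowGraph Λ') J * spinEmbed (siteIncl hΛ) (B k) -
            spinEmbed (siteIncl hΛ) (B k) * heisenbergHamiltonian n (windowGraph Λ') J) +
          ∑ l ∈ tt, (spinEmbed (siteIncl (hsh l)) (spinEmbed (siteAffEmb (ε l) (v l) Λ) (Y l)) -
            spinEmbed (siteIncl hΛ) (Y l)) +
          ∑ j ∈ u, b j • W j) +
        (∑ m' ∈ ah, ((dc m' : ℝ) : ℂ) • ((V m')ᴴ - V m') + ∑ k ∈ w, a k • M k)) :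
    c - ∑ k ∈ w, ‖a k‖ ≤ (heisenbergHamiltonian n (torusGraph 1 L) J).groundEnergy / (L : ℝ) := by
  have hL0 : (0 : ℝ) < L := by exact_mod_cast (show 0 < L by omega)
  rw [le_div_iff₀ hL0]
  exact heisenbergChain_groundEnergy_ge_of_window_certificate n J hL hΛ hclosed hz he hInj hΛm O s B tt ε
    v hsh Y u b W mq hmq hW ah dc V w a M hM hcert

end Window

end Literature.MathematicalPhysics.QuantumLattice
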